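import Summits.BirchSwinnertonDyer.BirchSwinnertonDyer.Theorems.SignedLowerHalvesSmallImageLowerHalfBothSignsRttD2SeqJ3TowerPairing
import HarnessLib

/-!
# Route `SignedLowerHalves`, crux L `SmallImageLowerHalfBothSigns` (stmt-BirchSwinnertonDyer-23599), line `rtt_w3` v14 → v15 — E2, row J3
# (Galois side, part α′): THE FINITE-LEVEL LAYER-PAIRING SOCKET `(n, k)` AND ITS TOWER PAIRING
# (from pairings `H¹(G_P(K_n), T*/p^k) × H¹(K_{n,v}, M[p^k]) → ℚ/ℤ` to the socket `TowerPairing` of part α)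

WIDTH seat `bsd-line-slh-p3-w3` g22 under LEAD `cruxlead-stmt-BirchSwinnertonDyer-23599` g11 (cell `bsd-ssimc`; KEY 2026-08-30T18:56:57Z, RULING (F1)/(F2) 19:25:38Z:
junction carrier `B' ⊆ B` strict, `γ₁ := γK⁻¹`); helper `--supports stmt-BirchSwinnertonDyer-23599`. DEFINITIONS WITH BODIES + THEOREMS; no named fact, no instance beyond
the structure-field projection, no `sorry`. HONEST FRAMING: bookkeeping — the local Tate pairings of the layers, their naturalities and the Poitou–Tate identities are the
content of an INHABITANT of the socket (part β); E2, crux L, crux M and BSD remain OPEN and are proved for NO curve.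

WHAT. Part α (`…RttD2SeqJ3TowerPairing`, p783849) produces the junction pairing `P : B → (E^{ε}_{sat,v})^∨` with `hPX`/`hPC`/`hrec` from pairings of `B = I.H` with the
layers `H¹(U_n, M)`. Those, in turn, come from GENUINELY FINITE objects: the level groups `G_{n,k} := cycLayerCohO S κ θ′ P n k 1 = H¹(G_P(K_n), 𝒪 ⊗ μ_{p^k} ⊗ θ′)` of
honda's datum and finite-level local groups `L_{n,k}` (intended `H¹(K_{n,v}, M[p^k])`) mapping to `H¹(U_n, M)`. This file is the socket at level `(n, k)` and the passage
`(n, k) ⇝ n`: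
* §1 ★ `LayerPairing S M γ_v I`: transition maps `coresLE`/`redLE` on the `G_{n,k}` for ALL `n ≤ n′`, `k ≤ k′` (refl/trans, agreement with honda's one-step
  `cycLayerCoresO`/`cycLayerRedO`, commutation), abstract local carriers `L n k` with `toH1 : L_{n,k} → H¹(U_n, M)`, `resLE`/`inclLE`/`conjL`/`scalarL` over `toH1`,
  EXHAUSTION (`H¹(U_n, M) = ⋃_k toH1(L_{n,k})`, `p`-primary `M`) and KERNEL CONTROL (`toH1 ℓ = 0 ⇒ inclLE ℓ = 0` deeper — finiteness of `M^{U_n}`), and the pairings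
  `pairNK n k : G_{n,k} → Hom(L_{n,k}, ℚ/ℤ)` with the four laws cores ⊣ res, red ⊣ incl, `conj_{γ_B} ⊣ conjL` (lifting `conj_{γ_v}`: the involution of (F2)),
  `H¹(a ⊗ id) ⊣ a`. Cast-free by design (no arithmetic in indices).
* §2 `proj_eq_coresLE`/`proj_eq_redLE`: honda's projections of `b ∈ B` form a `coresLE`/`redLE`-compatible family.
* §3 ★★ `pairNK_proj_eq_of_toH1_eq` (independence of the finite-level lift), `pairLayer` and ★★★ `LayerPairing.towerPairing : TowerPairing S M γ_v I` — so that part α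
  applies: `(𝓛.towerPairing I).pairing : B →+ Hom(E^{ε}_{sat,v}, ℚ/ℤ)` with `hPX`/`hPC`, and `hrec` from the layers.
Sequel (part α″): `hPT` on the strict carrier `B'` by König's lemma over the finite `G_{n,k}`.
References: [Rubin2000] Thm. 1.7.3, §4.2; [NeukirchSchmidtWingberg2008] I §5 Prop. 1.5.3 (iv), (7.2.6); [Kato2004Asterisque] §8.2 (p. 180), §17.13; [Kobayashi2003] Thm. 7.3 i);
[PerrinRiou1994Invent] §3.6.1.
-/

set_option autoImplicit false
set_option linter.dupNamespace false -- D-0017: single-problem summit, the namespace repeats the problem name by design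
noncomputable section

open scoped Classical
open NumberField IsDedekindDomain Field

namespace Summit.BirchSwinnertonDyer.BirchSwinnertonDyer.Theorems.SmallImageRttD2Seq

open Literature.NumberTheory.EllipticCurves Literature.NumberTheory.EllipticCurves.Kobayashi2003
  Literature.NumberTheory.EllipticCurves.GreenbergVatsal2000 Literature.NumberTheory.GaloisRepresentations
  Summit.BirchSwinnertonDyer.BirchSwinnertonDyer.Theorems.SmallImageCharSignedSelmer
  Summit.BirchSwinnertonDyer.BirchSwinnertonDyer.Theorems.SmallImageRttD2J1

/-! ## §1. The finite-level socket -/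

section Socket

variable {K : Type} [Field K] [NumberField K] {p : ℕ} [Fact p.Prime] (S : Set (PadicAlgCl p))
  (M : Type) [AddCommGroup M] [TopologicalSpace M] [DiscreteTopology M] [Module (padicCoeffIntegers S) M]
  {v : HeightOneSpectrum (𝓞 K)} [DistribMulAction (absoluteGaloisGroup (v.adicCompletion K)) M]
  [SMulCommClass (absoluteGaloisGroup (v.adicCompletion K)) (padicCoeffIntegers S) M]
  (γv : absoluteGaloisGroup (v.adicCompletion K))

/-- ★ **The finite-level layer-pairing socket of J3.** Around honda's level groups `G_{n,k} = cycLayerCohO S κ θ′ P n k 1 = H¹(G_P(K_n), 𝒪 ⊗ μ_{p^k} ⊗ θ′)`: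
(a) transition maps `coresLE (n ≤ n′)` / `redLE (k ≤ k′)` (intended: the corestriction `cor_{K_{n′}/K_n}` and the reduction of coefficients `μ_{p^{k′}} → μ_{p^k}`), functorial,
extending honda's one-step `cycLayerCoresO`/`cycLayerRedO`, and COMMUTING; (b) finite-level local carriers `L n k` (intended: `H¹(K_{n,v}, M[p^k])` on `U_n = Gal(K̄_v/K_n·K_v)`)
with their map `toH1` to `H¹(U_n, M)`, restriction `resLE`, inclusion-of-coefficients `inclLE`, a lift `conjL` of `conj_{γ_v}` and lifts `scalarL a` of the scalars, the
EXHAUSTION `H¹(U_n, M) = ⋃_k toH1(L_{n,k})` (`M` is `p`-primary) and the KERNEL CONTROL `toH1 ℓ = 0 ⇒ ∃ k′ ≥ k, inclLE ℓ = 0` (the kernel of `H¹(M[p^k]) → H¹(M)` is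
`δ(M^{U_n}/p^k)`, killed by `p^e` with `p^e M^{U_n} = 0`); (c) the pairings `pairNK n k : G_{n,k} → Hom(L_{n,k}, ℚ/ℤ)` (intended: `(y, ℓ) ↦ inv_{K_{n,v}}(loc_v y ∪ ℓ)` for the
`𝒪`-bilinear `(𝒪 ⊗ μ_{p^k} ⊗ θ′) × M[p^k] → μ_{p^k}`, `θ′ = θ_M⁻¹`) with the four laws: cores ⊣ res, red ⊣ incl, `conj_{γ_B} ⊣ conjL` (Galois invariance; `conjL` lifts
`conj_{γ_v}`, so this PRESUPPOSES `κ(γ_B) = −κ(res_ι γ_v)` — the involution of RULING (F2)), and `H¹(a ⊗ id) ⊣ a`. Nothing is asserted; an inhabitant is part β.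
[cite: NeukirchSchmidtWingberg2008, I §5 Prop. 1.5.3 (iv), (7.2.6)] [cite: Kato2004Asterisque, §8.2 (p. 180), §17.13] [cite: Rubin2000, §4.2] -/
structure LayerPairing (κ : ZpExtension K p) (γB : absoluteGaloisGroup K) (θ' : absoluteGaloisGroup K →ₜ* (padicCoeffIntegers S)ˣ)
    (P : Set (HeightOneSpectrum (𝓞 K))) : Type 1 where
  /-- (a) corestriction `G_{n′,k} → G_{n,k}` for `n ≤ n′`. -/
  coresLE : ∀ {n n' : ℕ}, n ≤ n' → ∀ k : ℕ, cycLayerCohO S κ θ' P n' k 1 →+ cycLayerCohO S κ θ' P n k 1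
  /-- (a) reduction `G_{n,k′} → G_{n,k}` for `k ≤ k′`. -/
  redLE : ∀ (n : ℕ) {k k' : ℕ}, k ≤ k' → cycLayerCohO S κ θ' P n k' 1 →+ cycLayerCohO S κ θ' P n k 1
  /-- `coresLE` along `n ≤ n` is the identity. -/
  coresLE_refl : ∀ (n k : ℕ) (y : cycLayerCohO S κ θ' P n k 1), coresLE (le_refl n) k y = y
  /-- `coresLE` is transitive. -/
  coresLE_trans : ∀ {n n' n'' : ℕ} (h : n ≤ n') (h' : n' ≤ n'') (k : ℕ) (y : cycLayerCohO S κ θ' P n'' k 1),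
    coresLE h k (coresLE h' k y) = coresLE (h.trans h') k y
  /-- `coresLE` along `n ≤ n+1` is honda's `cycLayerCoresO`. -/
  coresLE_succ : ∀ (n k : ℕ) (y : cycLayerCohO S κ θ' P (n + 1) k 1), coresLE (Nat.le_succ n) k y = cycLayerCoresO S κ θ' P n k 1 y
  /-- `redLE` along `k ≤ k` is the identity. -/
  redLE_refl : ∀ (n k : ℕ) (y : cycLayerCohO S κ θ' P n k 1), redLE n (le_refl k) y = y
  /-- `redLE` is transitive. -/
  redLE_trans : ∀ (n : ℕ) {k k' k'' : ℕ} (h : k ≤ k') (h' : k' ≤ k'') (y : cycLayerCohO S κ θ' P n k'' 1),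
    redLE n h (redLE n h' y) = redLE n (h.trans h') y
  /-- `redLE` along `k ≤ k+1` is honda's `cycLayerRedO`. -/
  redLE_succ : ∀ (n k : ℕ) (y : cycLayerCohO S κ θ' P n (k + 1) 1), redLE n (Nat.le_succ k) y = cycLayerRedO S κ θ' P n k 1 y
  /-- corestriction and reduction commute. -/
  coresLE_redLE : ∀ {n n' : ℕ} (h : n ≤ n') {k k' : ℕ} (h' : k ≤ k') (y : cycLayerCohO S κ θ' P n' k' 1),
    coresLE h k (redLE n' h' y) = redLE n h' (coresLE h k' y)
  /-- (b) the finite-level local carriers `L_{n,k}` (intended `H¹(K_{n,v}, M[p^k])`). -/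
  L : ℕ → ℕ → Type
  /-- `L_{n,k}` is an abelian group. -/
  [addCommGroup : ∀ n k : ℕ, AddCommGroup (L n k)]
  /-- the map `L_{n,k} → H¹(U_n, M)` (intended: induced by `M[p^k] ⊆ M`). -/
  toH1 : ∀ n k : ℕ, L n k →+ subgroupH1 (localSubgroupOfEmb (κ.layerSubgroup n) (closureEmb (K := K) (v.adicCompletion K))) M
  /-- restriction `L_{n,k} → L_{n′,k}` for `n ≤ n′`. -/
  resLE : ∀ {n n' : ℕ}, n ≤ n' → ∀ k : ℕ, L n k →+ L n' k
  /-- inclusion of coefficients `L_{n,k} → L_{n,k′}` for `k ≤ k′`. -/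
  inclLE : ∀ (n : ℕ) {k k' : ℕ}, k ≤ k' → L n k →+ L n k'
  /-- `toH1` intertwines `resLE` with the restriction of the local tower. -/
  toH1_resLE : ∀ {n n' : ℕ} (h : n ≤ n') (k : ℕ) (ℓ : L n k),
    toH1 n' k (resLE h k ℓ) = resOfLe M (localSubgroupOfEmb_layerSubgroup_antitone κ v h) (toH1 n k ℓ)
  /-- `toH1` is unchanged by `inclLE`. -/
  toH1_inclLE : ∀ (n : ℕ) {k k' : ℕ} (h : k ≤ k') (ℓ : L n k), toH1 n k' (inclLE n h ℓ) = toH1 n k ℓ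
  /-- a lift of `conj_{γ_v}` to `L_{n,k}`. -/
  conjL : ∀ n k : ℕ, L n k →+ L n k
  /-- `conjL` lifts `conj_{γ_v}`. -/
  toH1_conjL : ∀ (n k : ℕ) (ℓ : L n k), toH1 n k (conjL n k ℓ) =
    (haveI := normal_localSubgroupOfEmb_layerSubgroup κ v n
     conjH1 (localSubgroupOfEmb (κ.layerSubgroup n) (closureEmb (K := K) (v.adicCompletion K))) M γv (toH1 n k ℓ))
  /-- lifts of the scalars `a ∈ 𝒪` to `L_{n,k}`. -/
  scalarL : ∀ n k : ℕ, padicCoeffIntegers S → (L n k →+ L n k)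
  /-- `scalarL a` lifts `scalarH1 a`. -/
  toH1_scalarL : ∀ (n k : ℕ) (a : padicCoeffIntegers S) (ℓ : L n k), toH1 n k (scalarL n k a ℓ) =
    GreenbergSelmer.scalarH1 (localSubgroupOfEmb (κ.layerSubgroup n) (closureEmb (K := K) (v.adicCompletion K))) M a (toH1 n k ℓ)
  /-- exhaustion: every class of `H¹(U_n, M)` comes from some `L_{n,k}`. -/
  exhaust : ∀ (n : ℕ) (c : subgroupH1 (localSubgroupOfEmb (κ.layerSubgroup n) (closureEmb (K := K) (v.adicCompletion K))) M), ∃ (k : ℕ) (ℓ : L n k), toH1 n k ℓ = c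
  /-- kernel control: a class dying in `H¹(U_n, M)` dies in some `L_{n,k′}`. -/
  ker_toH1 : ∀ (n k : ℕ) (ℓ : L n k), toH1 n k ℓ = 0 → ∃ (k' : ℕ) (h : k ≤ k'), inclLE n h ℓ = 0
  /-- (c) the pairing `G_{n,k} × L_{n,k} → ℚ/ℤ`. -/
  pairNK : ∀ n k : ℕ, cycLayerCohO S κ θ' P n k 1 →+ (L n k →+ AddCircle (1 : ℚ))
  /-- cores ⊣ res. -/
  pairNK_coresLE : ∀ {n n' : ℕ} (h : n ≤ n') (k : ℕ) (y : cycLayerCohO S κ θ' P n' k 1) (ℓ : L n k),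
    pairNK n k (coresLE h k y) ℓ = pairNK n' k y (resLE h k ℓ)
  /-- red ⊣ incl. -/
  pairNK_redLE : ∀ (n : ℕ) {k k' : ℕ} (h : k ≤ k') (y : cycLayerCohO S κ θ' P n k' 1) (ℓ : L n k),
    pairNK n k (redLE n h y) ℓ = pairNK n k' y (inclLE n h ℓ)
  /-- `conj_{γ_B} ⊣ conjL` (the involution). -/
  pairNK_conj : ∀ (n k : ℕ) (y : cycLayerCohO S κ θ' P n k 1) (ℓ : L n k),
    pairNK n k (cycLayerConjO S κ θ' P n k 1 γB y) ℓ = pairNK n k y (conjL n k ℓ)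
  /-- `H¹(a ⊗ id) ⊣ a`. -/
  pairNK_scalar : ∀ (n k : ℕ) (a : padicCoeffIntegers S) (y : cycLayerCohO S κ θ' P n k 1) (ℓ : L n k),
    pairNK n k (cycLayerScalarO S κ θ' P n k 1 a y) ℓ = pairNK n k y (scalarL n k a ℓ)

attribute [instance] LayerPairing.addCommGroup

end Socket

namespace LayerPairing

variable {K : Type} [Field K] [NumberField K] {p : ℕ} [Fact p.Prime] {κ : ZpExtension K p} {S : Set (PadicAlgCl p)}
  {M : Type} [AddCommGroup M] [TopologicalSpace M] [DiscreteTopology M] [Module (padicCoeffIntegers S) M]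
  {v : HeightOneSpectrum (𝓞 K)} [DistribMulAction (absoluteGaloisGroup (v.adicCompletion K)) M]
  [SMulCommClass (absoluteGaloisGroup (v.adicCompletion K)) (padicCoeffIntegers S) M]
  {γv : absoluteGaloisGroup (v.adicCompletion K)}
  {γB : absoluteGaloisGroup K} {θ' : absoluteGaloisGroup K →ₜ* (padicCoeffIntegers S)ˣ} {P : Set (HeightOneSpectrum (𝓞 K))}
  (𝓛 : LayerPairing S M γv κ γB θ' P) {I : CycIwasawaCohomologyDataO S κ γB θ' P 1}

/-! ## §2. The projections of `b ∈ B` are `coresLE`/`redLE`-compatible -/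

/-- `proj_{n,k} b = coresLE (proj_{n′,k} b)` for `n ≤ n′` (honda's pin (P1), iterated). [cite: Kato2004Asterisque, §8.2 (p. 180)] -/
theorem proj_eq_coresLE (b : I.H) {n n' : ℕ} (h : n ≤ n') (k : ℕ) : I.proj n k b = 𝓛.coresLE h k (I.proj n' k b) := by
  induction n', h using Nat.le_induction with
  | base => rw [𝓛.coresLE_refl]
  | succ n' h ih => rw [← 𝓛.coresLE_trans h (Nat.le_succ n'), 𝓛.coresLE_succ, I.proj_cores, ih]

/-- `proj_{n,k} b = redLE (proj_{n,k′} b)` for `k ≤ k′` (honda's pin (P2), iterated). [cite: Kato2004Asterisque, §8.2 (p. 180)] -/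
theorem proj_eq_redLE (b : I.H) (n : ℕ) {k k' : ℕ} (h : k ≤ k') : I.proj n k b = 𝓛.redLE n h (I.proj n k' b) := by
  induction k', h using Nat.le_induction with
  | base => rw [𝓛.redLE_refl]
  | succ k' h ih => rw [← 𝓛.redLE_trans n h (Nat.le_succ k'), 𝓛.redLE_succ, I.proj_red, ih]

/-! ## §3. The tower pairing of a layer pairing -/

/-- ★★ **Independence of the finite-level lift**: if `ℓ ∈ L_{n,k}` and `ℓ′ ∈ L_{n,k′}` have the same image in `H¹(U_n, M)`, then `⟨proj_{n,k} b, ℓ⟩ = ⟨proj_{n,k′} b, ℓ′⟩`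
(push both to `max k k′` by red ⊣ incl, the difference dies deeper by the kernel control, red ⊣ incl again). [cite: Rubin2000, §4.2] [cite: Kato2004Asterisque, §8.2 (p. 180)] -/
theorem pairNK_proj_eq_of_toH1_eq (b : I.H) {n k k' : ℕ} (ℓ : 𝓛.L n k) (ℓ' : 𝓛.L n k') (h : 𝓛.toH1 n k ℓ = 𝓛.toH1 n k' ℓ') :
    𝓛.pairNK n k (I.proj n k b) ℓ = 𝓛.pairNK n k' (I.proj n k' b) ℓ' := by
  have hd : 𝓛.toH1 n (max k k') (𝓛.inclLE n (le_max_left k k') ℓ - 𝓛.inclLE n (le_max_right k k') ℓ') = 0 := by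
    rw [map_sub, 𝓛.toH1_inclLE, 𝓛.toH1_inclLE, h, sub_self]
  obtain ⟨k'', hk'', h0⟩ := 𝓛.ker_toH1 n (max k k') _ hd
  rw [𝓛.proj_eq_redLE b n (le_max_left k k'), 𝓛.pairNK_redLE, 𝓛.proj_eq_redLE b n (le_max_right k k'), 𝓛.pairNK_redLE, ← sub_eq_zero, ← map_sub,
    𝓛.proj_eq_redLE b n hk'', 𝓛.pairNK_redLE, h0, map_zero]

/-- A level carrying a given class of `H¹(U_n, M)` (a choice; exhaustion). [cite: SerreGaloisCohomology1997, I §2.2] -/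
def liftLevel (n : ℕ) (c : subgroupH1 (localSubgroupOfEmb (κ.layerSubgroup n) (closureEmb (K := K) (v.adicCompletion K))) M) : ℕ :=
  (𝓛.exhaust n c).choose

/-- A finite-level lift of a class of `H¹(U_n, M)` (a choice). [cite: SerreGaloisCohomology1997, I §2.2] -/
def lift (n : ℕ) (c : subgroupH1 (localSubgroupOfEmb (κ.layerSubgroup n) (closureEmb (K := K) (v.adicCompletion K))) M) : 𝓛.L n (𝓛.liftLevel n c) :=
  (𝓛.exhaust n c).choose_spec.choose

/-- The chosen lift maps to the class. [cite: SerreGaloisCohomology1997, I §2.2] -/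
theorem toH1_lift (n : ℕ) (c : subgroupH1 (localSubgroupOfEmb (κ.layerSubgroup n) (closureEmb (K := K) (v.adicCompletion K))) M) :
    𝓛.toH1 n (𝓛.liftLevel n c) (𝓛.lift n c) = c :=
  (𝓛.exhaust n c).choose_spec.choose_spec

/-- The layer pairing `⟨b, c⟩_n := ⟨proj_{n,k} b, ℓ⟩` for a lift `ℓ ∈ L_{n,k}` of `c` (as a bare function). [cite: PerrinRiou1994Invent, §3.6.1] -/
def pairLayerFun (n : ℕ) (b : I.H) (c : subgroupH1 (localSubgroupOfEmb (κ.layerSubgroup n) (closureEmb (K := K) (v.adicCompletion K))) M) : AddCircle (1 : ℚ) :=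
  𝓛.pairNK n (𝓛.liftLevel n c) (I.proj n (𝓛.liftLevel n c) b) (𝓛.lift n c)

/-- `pairLayerFun n b c = ⟨proj_{n,k} b, ℓ⟩` for EVERY lift `ℓ` of `c`. [cite: PerrinRiou1994Invent, §3.6.1] -/
theorem pairLayerFun_eq (n : ℕ) (b : I.H) {k : ℕ} (ℓ : 𝓛.L n k)
    (c : subgroupH1 (localSubgroupOfEmb (κ.layerSubgroup n) (closureEmb (K := K) (v.adicCompletion K))) M) (h : 𝓛.toH1 n k ℓ = c) :
    𝓛.pairLayerFun n b c = 𝓛.pairNK n k (I.proj n k b) ℓ :=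
  𝓛.pairNK_proj_eq_of_toH1_eq b _ ℓ ((𝓛.toH1_lift n c).trans h.symm)

/-- **The layer pairing `pairLayer n : B →+ Hom(H¹(U_n, M), ℚ/ℤ)`** of a finite-level socket. [cite: PerrinRiou1994Invent, §3.6.1] [cite: Kato2004Asterisque, §17.13] -/
def pairLayer (n : ℕ) : I.H →+ (subgroupH1 (localSubgroupOfEmb (κ.layerSubgroup n) (closureEmb (K := K) (v.adicCompletion K))) M →+ AddCircle (1 : ℚ)) where
  toFun b :=
    { toFun := 𝓛.pairLayerFun n b
      map_zero' := by
        rw [𝓛.pairLayerFun_eq n b (k := 0) 0 0 (map_zero _), map_zero]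
      map_add' := fun c d ↦ by
        obtain ⟨k, ℓ, hℓ⟩ := 𝓛.exhaust n c
        obtain ⟨k', ℓ', hℓ'⟩ := 𝓛.exhaust n d
        have hc : 𝓛.toH1 n (max k k') (𝓛.inclLE n (le_max_left k k') ℓ) = c := by rw [𝓛.toH1_inclLE, hℓ]
        have hd : 𝓛.toH1 n (max k k') (𝓛.inclLE n (le_max_right k k') ℓ') = d := by rw [𝓛.toH1_inclLE, hℓ']
        rw [𝓛.pairLayerFun_eq n b _ c hc, 𝓛.pairLayerFun_eq n b _ d hd,
          𝓛.pairLayerFun_eq n b (𝓛.inclLE n (le_max_left k k') ℓ + 𝓛.inclLE n (le_max_right k k') ℓ') (c + d) (by rw [map_add, hc, hd]), map_add] }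
  map_zero' := by
    ext c
    change 𝓛.pairLayerFun n 0 c = 0
    rw [pairLayerFun, map_zero, map_zero, AddMonoidHom.zero_apply]
  map_add' := fun b b' ↦ by
    ext c
    change 𝓛.pairLayerFun n (b + b') c = 𝓛.pairLayerFun n b c + 𝓛.pairLayerFun n b' c
    simp only [pairLayerFun, map_add, AddMonoidHom.add_apply]

/-- Unfolding `pairLayer` (definitional). [cite: PerrinRiou1994Invent, §3.6.1] -/
theorem pairLayer_apply (n : ℕ) (b : I.H) (c : subgroupH1 (localSubgroupOfEmb (κ.layerSubgroup n) (closureEmb (K := K) (v.adicCompletion K))) M) :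
    𝓛.pairLayer n b c = 𝓛.pairLayerFun n b c :=
  rfl

/-- `pairLayer n b (toH1 ℓ) = ⟨proj_{n,k} b, ℓ⟩`. [cite: PerrinRiou1994Invent, §3.6.1] -/
theorem pairLayer_apply_toH1 (n : ℕ) (b : I.H) {k : ℕ} (ℓ : 𝓛.L n k) : 𝓛.pairLayer n b (𝓛.toH1 n k ℓ) = 𝓛.pairNK n k (I.proj n k b) ℓ := by
  rw [pairLayer_apply]
  exact 𝓛.pairLayerFun_eq n b ℓ _ rfl

variable (I) in
/-- ★★★ **The tower pairing of a finite-level layer pairing** — the socket of part α (`TowerPairing`, p783849) INHABITED from the `(n, k)`-socket: (i) restriction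
compatibility from cores ⊣ res and (P1); (ii) the conjugation law from `conj_{γ_B} ⊣ conjL`, `toH1 ∘ conjL = conj_{γ_v} ∘ toH1` and honda's pin (P5); (iii) the `𝒪`-balance from
`H¹(a ⊗ id) ⊣ a` and pin (P7). Hence part α's `pairing`, `pairing_X_smul` (hPX), `pairing_C_smul` (hPC), `pairing_locSat_eq_zero` (hrec ⟸ layers) apply to
`𝓛.towerPairing`. [cite: Kato2004Asterisque, §17.13] [cite: NeukirchSchmidtWingberg2008, I §5 Prop. 1.5.3 (iv), (7.2.6)] [cite: Kobayashi2003, Thm. 7.3 i)] -/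
def towerPairing : TowerPairing S M γv I where
  pairL := 𝓛.pairLayer
  pairL_resOfLe := fun {n m} h b c ↦ by
    obtain ⟨k, ℓ, rfl⟩ := 𝓛.exhaust n c
    rw [pairLayer_apply_toH1, ← 𝓛.toH1_resLE h k ℓ, pairLayer_apply_toH1, ← 𝓛.pairNK_coresLE, ← 𝓛.proj_eq_coresLE]
  pairL_X_smul := fun n b c ↦ by
    haveI := normal_localSubgroupOfEmb_layerSubgroup κ v n
    obtain ⟨k, ℓ, rfl⟩ := 𝓛.exhaust n c
    rw [pairLayer_apply_toH1, ← 𝓛.toH1_conjL, pairLayer_apply_toH1, pairLayer_apply_toH1, I.proj_X_smul, map_sub, AddMonoidHom.sub_apply, 𝓛.pairNK_conj]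
  pairL_C_smul := fun n a b c ↦ by
    obtain ⟨k, ℓ, rfl⟩ := 𝓛.exhaust n c
    rw [pairLayer_apply_toH1, ← 𝓛.toH1_scalarL, pairLayer_apply_toH1, I.proj_C_smul, 𝓛.pairNK_scalar]

/-- The layer pairings of `𝓛.towerPairing` are the `pairLayer n` (definitional). [cite: PerrinRiou1994Invent, §3.6.1] -/
theorem towerPairing_pairL (n : ℕ) : (𝓛.towerPairing I).pairL n = 𝓛.pairLayer n :=
  rfl

/-- ★ **The junction pairing of a finite-level socket on finite-level data**: `P b (res_n (toH1 ℓ)) = ⟨proj_{n,k} b, ℓ⟩` for `res_n(toH1 ℓ) ∈ E^{ε}_{sat,v}`.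
[cite: Kobayashi2003, Thm. 7.3 i)] [cite: Kato2004Asterisque, §17.13] -/
theorem towerPairing_pairing_apply {V : WeierstrassCurve K} {j : V.geomPrimaryTorsion p →+ M} {ε : ℤˣ}
    (hstab : ∀ m : M, IsOpen (MulAction.stabilizer (absoluteGaloisGroup (v.adicCompletion K)) m : Set (absoluteGaloisGroup (v.adicCompletion K))))
    (b : I.H) {n k : ℕ} (ℓ : 𝓛.L n k)
    (hℓ : resOfLe M (localSubgroupOfEmb_kerSubgroup_le κ v n) (𝓛.toH1 n k ℓ) ∈ localCondInftySat κ M (padicCoeffIntegers S) V j ε v) :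
    (𝓛.towerPairing I).pairing hstab b ⟨_, hℓ⟩ = 𝓛.pairNK n k (I.proj n k b) ℓ := by
  rw [TowerPairing.pairing_apply_resOfLe, towerPairing_pairL, pairLayer_apply_toH1]

end LayerPairing

end Summit.BirchSwinnertonDyer.BirchSwinnertonDyer.Theorems.SmallImageRttD2Seq

end
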